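import Summits.BirchSwinnertonDyer.Rank1Residual.X11b.KolyvaginShaFiniteAtPrime
import Summits.BirchSwinnertonDyer.Rank1Residual.X11b.Three.KolyvaginHexcIdle
import HarnessLib

/-!
# `Ш(E/K)[3^∞]` finite on X11b @ 3 (`3 ‖ N_E`) from the cite-only printed inputs AT `p = 3`:
# SIX labels, FIVE on the Kodaira–Néron sub-class (KN₃) — no `hexc`, no `hK1`, no other prime

Cell `b2b-bsdres`, team x11b3 (N8/O2: X11b @ 3, `3 ‖ N`, `r = 1`, `E[3]` irreducible); seat
x11b3-p2 GEN 35 ((P2-PERPRIME)).  Summit-side THEOREM-ONLY file (no definition, no named fact, no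
`sorry`); `K : Type`; the literal prime `3`.

HONEST FRAMING (binding): **plumbing — the per-prime telescope
`KolyvaginAssembly.sha_primary_finite_at_of_leafInputs_of_poitouTate[_of_kodairaNeron]`
(`X11b/KolyvaginShaFiniteAtPrime`) READ AT `p = 3` on `3 ‖ N_E`, with `¬ CM` and
`d_K ∉ {−3, −4}` SUPPLIED (x11b3-p2 GEN 34 item 6, `X11b/Three/KolyvaginHexcIdle`: a curve with
multiplicative reduction at `3` has no CM — `WeierstrassCurve.not_hasMultiplicativeReductionAtPrime_of_hasCM`;
`3 ∣ N` with the Heegner hypothesis excludes `ℚ(√−3)`, `ℚ(i)` —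
`KolyvaginHexc.discr_ne_of_satisfiesHeegnerHypothesis_of_three_dvd`); nothing discharged beyond
that.**  Compared with the telescopes of record on X11b @ 3 (item 6
`Three.sha_primary_finite_of_leafInputs_of_poitouTate_of_mult_three`: SEVEN labels {`hPT`,
`hrec`, `hCM`, `h53`, `hGZ`, `hγ`, `hK1`} quantified over ALL primes; γ p320077 on (KN∀)): the
conclusion here is the `3`-PRIMARY statement only — `Ш(E/K)[3^∞]` finite, for `ρ̄_{E,3}` onto —
and the price list is read AT `3`: {`hPT`, `hrec`, `hCM₃`, `h53₃`, `hGZ₃`, `hγ₃`} (SIX; `hK1` and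
`hexc` do not occur), and on (KN₃) = {`3 ∤ ord_v(Δ_min(E/K))` at every multiplicative `v`; no
additive place of Kodaira type IV / IV*} the label `hGZ₃` is SUPPLIED by
`KolyvaginHloc.hGZ_of_kodairaNeron` at `p = 3` (p319336 `_three`), leaving FIVE: {`hPT`, `hrec`,
`hCM₃`, `h53₃`, `hγ₃`}.  Each `X₃` is the all-`p` label `X` of p306701 / p307212 with its
quantifier over `p` removed and `p := 3` (token for token otherwise), hence implied by it.
`ρ̄_{E,3}` onto is an explicit hypothesis of the conclusion (the all-`p` telescopes put the
non-surjective primes under `hK1`); X11b @ 3 asks `E[3]` irreducible, so the complement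
{irreducible, not onto} is NOT covered here (it is [K1] / Serre territory, as before).  Cite-only
labelled hypotheses, NOT Literature facts, NOT discharged; nothing booked; no mark / label /
count / tier moves; node `Three.HsiehDescentAt₃` and its FOUR antecedents untouched; (KN₃) =
870 / 1 684 is census EVIDENCE (x11b3-p2 GEN 34), not asserted here.

## What is proved (namespace `…X11b.Three`)

* `sha_primary_finite_three_of_leafInputs_of_poitouTate` — on `3 ‖ N_E` (`hmult`), `N = N_E`:
  `Ш(E/K)[3^∞]` finite for `ρ̄_{E,3}` onto ⟸ EXACTLY {`hPT`, `hrec`, `hCM₃`, `h53₃`, `hGZ₃`,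
  `hγ₃`} (SIX).
* `sha_primary_finite_three_of_leafInputs_of_poitouTate_of_kodairaNeron` — the same on (KN₃)
  (`hKN3m`, `hKN3a`): EXACTLY {`hPT`, `hrec`, `hCM₃`, `h53₃`, `hγ₃`} (FIVE).
* `sha_primary_finite_three_of_classX11b_of_kodairaNeron` — the same for `(E, 3) ∈ ClassX11b W 3`
  (RESIDUAL-CASES row X11b: `r_an = 1 ∧ 3 ≠ 2 ∧ mult(3) ∧ irr(3)`; only `mult(3)` is used).

## References

* [McCallumLMS1991] W. G. McCallum, *Kolyvagin's work on Shafarevich–Tate groups*, LMS LNS 153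
  (1991), §1 Theorem (Kolyvagin) — per prime (held `book:editornd-l-functions-arithmetic`).
* [GrossLMS1991] B. H. Gross, same volume, Thm. 1.3 (2), §§3–8.
* [SilvermanATAEC1994] Thm. II.6.4 (CM ⇒ integral `j`); [SilvermanAEC2009] Thm. VII.6.1;
  [Darmon2004] Hyp. 3.9 / Prop. 3.8; [MilneADT2006] Ch. I Thm. 4.10(b).

presearch: `lean search 'sha_primary_finite_three'` → none; the `3`-primary-only statement on
X11b @ 3 has no rendering in the tree (lead GEN 28 R29-5 (2): "the tree has no 3-primary-only
telescope"); McCallum §1 per prime [corpus:book:editornd-l-functions-arithmetic p. 295].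
-/

noncomputable section

open scoped Classical
open WeierstrassCurve Field NumberField IsDedekindDomain
open Literature.NumberTheory.EllipticCurves Literature.NumberTheory.GaloisRepresentations
open Literature.NumberTheory.EllipticCurves.Rank1Residual
open Literature.NumberTheory.EllipticCurves.RingClassField
open Literature.NumberTheory.EllipticCurves.ModularForms
open Literature.NumberTheory.DiophantineGeometry Literature.NumberTheory.DiophantineGeometry.TateAlgorithm
open Summit.BirchSwinnertonDyer.Rank1Residual.X11b.KolyvaginAssembly

namespace Summit.BirchSwinnertonDyer.Rank1Residual.X11b.Three

-- `K : Type`: the tree's ring-class class field theory is universe `0`.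
variable {K : Type} [Field K] [NumberField K] {N : ℕ} {W : WeierstrassCurve ℚ}

/-- **`Ш(E/K)[3^∞]` finite on `3 ‖ N_E` from SIX cite-only inputs AT `3`** — the per-prime
telescope `KolyvaginAssembly.sha_primary_finite_at_of_leafInputs_of_poitouTate` at `p = 3` with
`¬ CM` (from `hmult`: multiplicative reduction at `3`, Silverman *ATAEC* II.6.4) and
`d_K ∉ {−3, −4}` (from `3 ∣ N_E` and the Heegner hypothesis,
`KolyvaginHexc.discr_ne_of_satisfiesHeegnerHypothesis_of_three_dvd`) SUPPLIED.  For `W` globally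
minimal at its conductor `N = N_E` (`hN`) with `3 ‖ N_E`, CONDITIONAL on EXACTLY {`hPT` (Poitou–Tate
named fact), `hrec` (Shimura reciprocity at conductor 1, named fact), `hCM` (Gross §3 at the
levels of `(3, M)`), `h53` ((A′-53) at those levels), `hGZ` ([GZ86 III (3.1)] at those levels),
`hγ` ((γ) at those levels)} — cite-only, NOT facts, NOT discharged; NO `hexc`, NO `hK1`; nothing
booked.  Conclusion: for `K` imaginary quadratic with the Heegner hypothesis, `P` a non-torsion
Heegner point and `ρ̄_{E,3}` onto, `Ш(E/K)[3^∞]` is finite.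
[cite: McCallumLMS1991, §1 Theorem (Kolyvagin)] [cite: GrossLMS1991, Thm. 1.3 (2), §§3–8]
[cite: SilvermanATAEC1994, Thm. II.6.4] -/
theorem sha_primary_finite_three_of_leafInputs_of_poitouTate [NeZero N] [W.IsGloballyMinimal]
    (hPT : Literature.NumberTheory.GaloisCohomology.poitouTate_sum_localTatePairing_eq_zero K)
    (hN : ∀ [W.IsElliptic], N = W.conductorNorm ℤ)
    (hmult : W.HasMultiplicativeReductionAtPrime 3)
    (hrec : heegnerPointOfConductor_one_galoisConj N W K)
    (hCM : ∀ [W.IsElliptic] (_hK : IsImaginaryQuadratic K) (_hH : SatisfiesHeegnerHypothesis N K)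
      (Dt : ModularParametrizationData W N) (β : ℤ) (ι : K →+* ℂ),
      (4 * N : ℤ) ∣ β ^ 2 - NumberField.discr K →
      ∀ {M : ℕ}, 1 ≤ M → ∀ (m : ℕ), Squarefree m →
      (∀ q ∈ m.primeFactors, IsKolyvaginPrime N W K 3 q ∧ FrobEqFrobInfty W K (3 ^ M) q) →
      ∃ y : (W.baseChange (ringClassField K ι m)).toAffine.Point,
        WeierstrassCurve.Affine.Point.map (W' := W) (ringClassField K ι m).subtype.toRatAlgHom y =
          heegnerPointComplexOfConductor Dt (NumberField.discr K) β m)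
    (h53 : ∀ [W.IsElliptic] (_hK : IsImaginaryQuadratic K) (_hH : SatisfiesHeegnerHypothesis N K)
      (Dt : ModularParametrizationData W N) (β : ℤ) (ι : K →+* ℂ) {M : ℕ}
      (_hM : 1 ≤ M) {n : ℕ} (_hn : Squarefree n)
      (_hKol : ∀ q ∈ n.primeFactors, IsKolyvaginPrime N W K 3 q ∧ FrobEqFrobInfty W K (3 ^ M) q)
      (d : (m : ℕ) → m ∣ n → KolyvaginHeegnerData Dt β ι m) (m : ℕ) (hm : m ∣ n)
      (τm : ringClassField K ι m ≃ₐ[ℚ] ringClassField K ι m),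
      (∀ x : ringClassField K ι m, ((τm x : ringClassField K ι m) : ℂ) = starRingEnd ℂ x) →
      ∃ σ' ∈ ringClassGal ι m, IsOfFinAddOrder
        (pointGalHom W (ringClassField K ι m) τm (d m hm).y -
          (-W.rootNumber) • pointGalHom W (ringClassField K ι m) σ' (d m hm).y))
    (hGZ : ∀ [W.IsElliptic] (_hK : IsImaginaryQuadratic K) (_hH : SatisfiesHeegnerHypothesis N K)
      (Dt : ModularParametrizationData W N) (β : ℤ) (ι : K →+* ℂ) {M : ℕ} (_hM : 1 ≤ M) {n : ℕ}
      (_hn : Squarefree n)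
      (_hKol : ∀ q ∈ n.primeFactors, IsKolyvaginPrime N W K 3 q ∧ FrobEqFrobInfty W K (3 ^ M) q)
      (d : (m : ℕ) → m ∣ n → KolyvaginHeegnerData Dt β ι m),
      ∃ n' : ℤ, IsCoprime ((3 ^ M : ℕ) : ℤ) n' ∧
        ∀ (m : ℕ) (hm : m ∣ n) (γ : ringClassField K ι m ≃ₐ[ℚ] ringClassField K ι m),
          γ ∈ ringClassGal ι m → ∀ v : HeightOneSpectrum (𝓞 K),
            ¬ (W.baseChange K).HasGoodReductionAt v →
            n' • pointsMap (W.baseChange K) (v.adicCompletion K)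
                ((d m hm).toGeomPoints (pointGalHom W (ringClassField K ι m) γ (d m hm).y)) ∈
              E0Receptacle (W.baseChange K) v ∧
            ∀ (ℓ : ℕ) (hℓ : ℓ ∈ m.primeFactors)
              (hle : ringClassField K ι (m / ℓ) ≤ ringClassField K ι m),
              n' • pointsMap (W.baseChange K) (v.adicCompletion K)
                  ((d m hm).toGeomPoints (pointGalHom W (ringClassField K ι m) γ
                    (WeierstrassCurve.Affine.Point.map (W' := W)
                      ((RingClassField.inclusion ι hle).restrictScalars ℚ)
                      (d (m / ℓ)
                        ((Nat.div_dvd_of_dvd (Nat.dvd_of_mem_primeFactors hℓ)).trans hm)).y))) ∈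
                E0Receptacle (W.baseChange K) v)
    (hγ : ∀ [W.IsElliptic] (_hK : IsImaginaryQuadratic K) (_hH : SatisfiesHeegnerHypothesis N K)
      (Dt : ModularParametrizationData W N) (β : ℤ) (ι : K →+* ℂ) {M : ℕ}
      (_hM : 1 ≤ M) {n : ℕ} (_hn : Squarefree n)
      (_hKol : ∀ q ∈ n.primeFactors, IsKolyvaginPrime N W K 3 q ∧ FrobEqFrobInfty W K (3 ^ M) q)
      (d : (m : ℕ) → m ∣ n → KolyvaginHeegnerData Dt β ι m)
      (m : ℕ) (hm : m ∣ n) (ℓ : ℕ) (hℓ : ℓ ∈ m.primeFactors) [Fact ℓ.Prime]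
      (hΔ : ¬ (ℓ : ℤ) ∣ minimalDiscriminantInt W) (φ₀ : absoluteGaloisGroup (ZMod ℓ)),
      (∀ x : AlgebraicClosure (ZMod ℓ), φ₀ • x = x ^ ℓ) →
      ∀ (hle : ringClassField K ι (m / ℓ) ≤ ringClassField K ι m)
        (γ : ringClassField K ι m ≃ₐ[ℚ] ringClassField K ι m), γ ∈ ringClassGal ι m →
        geomReduction hΔ ((RatClosure.pointsEquiv (K := K) W).symm
            ((d m hm).toGeomPoints (pointGalHom W (ringClassField K ι m) γ (d m hm).y))) =
          φ₀ • geomReduction hΔ ((RatClosure.pointsEquiv (K := K) W).symm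
            ((d m hm).toGeomPoints (pointGalHom W (ringClassField K ι m) γ
              (WeierstrassCurve.Affine.Point.map (W' := W)
                ((RingClassField.inclusion ι hle).restrictScalars ℚ)
                (d (m / ℓ)
                  ((Nat.div_dvd_of_dvd (Nat.dvd_of_mem_primeFactors hℓ)).trans hm)).y))))) :
    ∀ [W.IsElliptic] (_hK : IsImaginaryQuadratic K) (_hH : SatisfiesHeegnerHypothesis N K)
      {P : (W.baseChange K).toAffine.Point} (_hP : IsHeegnerPoint N W K P)
      (_hnt : ¬ IsOfFinAddOrder P) (_hρ : W.HasSurjectiveModNGaloisRep 3),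
      Set.Finite {c : (W.baseChange K).sha | ∃ j : ℕ, 3 ^ j • c = 0} := by
  intro _ hK hH P hP hnt hρ
  have h3 : 3 ∣ N := by
    rw [hN]
    exact (W.dvd_conductorNorm_iff_not_hasGoodReductionAtPrime 3).mpr
      (not_hasGoodReductionAtPrime_of_hasMultiplicativeReductionAtPrime 3 hmult)
  have hE : ¬ W.HasCM := fun hCM' ↦ W.not_hasMultiplicativeReductionAtPrime_of_hasCM hCM' 3 hmult
  have hD := KolyvaginHexc.discr_ne_of_satisfiesHeegnerHypothesis_of_three_dvd hK.1 hH h3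
  exact sha_primary_finite_at_of_leafInputs_of_poitouTate Nat.prime_three (by decide) hPT hN hrec
    hCM h53 hGZ hγ hE hK hD hH hP hnt hρ

/-- **`Ш(E/K)[3^∞]` finite on `3 ‖ N_E` from FIVE cite-only inputs AT `3` on the Kodaira–Néron
sub-class (KN₃)** — `sha_primary_finite_three_of_leafInputs_of_poitouTate` with its label `hGZ`
([GZ86 III (3.1)] at the levels of `(3, M)`) SUPPLIED by `KolyvaginHloc.hGZ_of_kodairaNeron` at
`p = 3` (Silverman *AEC* VII.6.1 over `K_v^nr`, p319336) under `hKN3m` (`3 ∤ ord_v(Δ_min(E/K))`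
at every multiplicative `v`) and `hKN3a` (no additive place of Kodaira type IV / IV*).  CONDITIONAL
on EXACTLY {`hPT`, `hrec`, `hCM`, `h53`, `hγ`} at `3` + `hN` + `hmult` + (KN₃); cite-only, NOT
discharged except `hGZ`; NO `hexc`, NO `hK1`; nothing booked; no mark; #(KN₃) not asserted.
[cite: McCallumLMS1991, §1 Theorem (Kolyvagin)] [cite: GrossLMS1991, Thm. 1.3 (2), Prop. 6.2 (1)]
[cite: SilvermanAEC2009, Thm. VII.6.1] -/
theorem sha_primary_finite_three_of_leafInputs_of_poitouTate_of_kodairaNeron [NeZero N]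
    [W.IsGloballyMinimal]
    (hPT : Literature.NumberTheory.GaloisCohomology.poitouTate_sum_localTatePairing_eq_zero K)
    (hN : ∀ [W.IsElliptic], N = W.conductorNorm ℤ)
    (hmult : W.HasMultiplicativeReductionAtPrime 3)
    (hrec : heegnerPointOfConductor_one_galoisConj N W K)
    (hCM : ∀ [W.IsElliptic] (_hK : IsImaginaryQuadratic K) (_hH : SatisfiesHeegnerHypothesis N K)
      (Dt : ModularParametrizationData W N) (β : ℤ) (ι : K →+* ℂ),
      (4 * N : ℤ) ∣ β ^ 2 - NumberField.discr K →
      ∀ {M : ℕ}, 1 ≤ M → ∀ (m : ℕ), Squarefree m →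
      (∀ q ∈ m.primeFactors, IsKolyvaginPrime N W K 3 q ∧ FrobEqFrobInfty W K (3 ^ M) q) →
      ∃ y : (W.baseChange (ringClassField K ι m)).toAffine.Point,
        WeierstrassCurve.Affine.Point.map (W' := W) (ringClassField K ι m).subtype.toRatAlgHom y =
          heegnerPointComplexOfConductor Dt (NumberField.discr K) β m)
    (h53 : ∀ [W.IsElliptic] (_hK : IsImaginaryQuadratic K) (_hH : SatisfiesHeegnerHypothesis N K)
      (Dt : ModularParametrizationData W N) (β : ℤ) (ι : K →+* ℂ) {M : ℕ}
      (_hM : 1 ≤ M) {n : ℕ} (_hn : Squarefree n)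
      (_hKol : ∀ q ∈ n.primeFactors, IsKolyvaginPrime N W K 3 q ∧ FrobEqFrobInfty W K (3 ^ M) q)
      (d : (m : ℕ) → m ∣ n → KolyvaginHeegnerData Dt β ι m) (m : ℕ) (hm : m ∣ n)
      (τm : ringClassField K ι m ≃ₐ[ℚ] ringClassField K ι m),
      (∀ x : ringClassField K ι m, ((τm x : ringClassField K ι m) : ℂ) = starRingEnd ℂ x) →
      ∃ σ' ∈ ringClassGal ι m, IsOfFinAddOrder
        (pointGalHom W (ringClassField K ι m) τm (d m hm).y -
          (-W.rootNumber) • pointGalHom W (ringClassField K ι m) σ' (d m hm).y))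
    (hKN3m : ∀ [W.IsElliptic] (v : HeightOneSpectrum (𝓞 K)),
      (W.baseChange K).HasMultiplicativeReductionAt v →
        ¬ 3 ∣ (W.baseChange K).ordMinimalDiscriminant v)
    (hKN3a : ∀ [W.IsElliptic] (v : HeightOneSpectrum (𝓞 K)),
      (W.baseChange K).HasAdditiveReductionAt v →
        (W.baseChange K).kodairaSymbolAt v ≠ KodairaSymbol.IV ∧
          (W.baseChange K).kodairaSymbolAt v ≠ KodairaSymbol.IVstar)
    (hγ : ∀ [W.IsElliptic] (_hK : IsImaginaryQuadratic K) (_hH : SatisfiesHeegnerHypothesis N K)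
      (Dt : ModularParametrizationData W N) (β : ℤ) (ι : K →+* ℂ) {M : ℕ}
      (_hM : 1 ≤ M) {n : ℕ} (_hn : Squarefree n)
      (_hKol : ∀ q ∈ n.primeFactors, IsKolyvaginPrime N W K 3 q ∧ FrobEqFrobInfty W K (3 ^ M) q)
      (d : (m : ℕ) → m ∣ n → KolyvaginHeegnerData Dt β ι m)
      (m : ℕ) (hm : m ∣ n) (ℓ : ℕ) (hℓ : ℓ ∈ m.primeFactors) [Fact ℓ.Prime]
      (hΔ : ¬ (ℓ : ℤ) ∣ minimalDiscriminantInt W) (φ₀ : absoluteGaloisGroup (ZMod ℓ)),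
      (∀ x : AlgebraicClosure (ZMod ℓ), φ₀ • x = x ^ ℓ) →
      ∀ (hle : ringClassField K ι (m / ℓ) ≤ ringClassField K ι m)
        (γ : ringClassField K ι m ≃ₐ[ℚ] ringClassField K ι m), γ ∈ ringClassGal ι m →
        geomReduction hΔ ((RatClosure.pointsEquiv (K := K) W).symm
            ((d m hm).toGeomPoints (pointGalHom W (ringClassField K ι m) γ (d m hm).y))) =
          φ₀ • geomReduction hΔ ((RatClosure.pointsEquiv (K := K) W).symm
            ((d m hm).toGeomPoints (pointGalHom W (ringClassField K ι m) γ
              (WeierstrassCurve.Affine.Point.map (W' := W)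
                ((RingClassField.inclusion ι hle).restrictScalars ℚ)
                (d (m / ℓ)
                  ((Nat.div_dvd_of_dvd (Nat.dvd_of_mem_primeFactors hℓ)).trans hm)).y))))) :
    ∀ [W.IsElliptic] (_hK : IsImaginaryQuadratic K) (_hH : SatisfiesHeegnerHypothesis N K)
      {P : (W.baseChange K).toAffine.Point} (_hP : IsHeegnerPoint N W K P)
      (_hnt : ¬ IsOfFinAddOrder P) (_hρ : W.HasSurjectiveModNGaloisRep 3),
      Set.Finite {c : (W.baseChange K).sha | ∃ j : ℕ, 3 ^ j • c = 0} :=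
  sha_primary_finite_three_of_leafInputs_of_poitouTate hPT hN hmult hrec hCM h53
    (@fun _ hK _ Dt _ ι _ _ _ hn hKol d ↦
      KolyvaginHloc.hGZ_of_kodairaNeron_three hK ι Dt hn hKol d hKN3m hKN3a) hγ

/-- **On the class X11b @ 3, `Ш(E/K)[3^∞]` is finite from FIVE cite-only inputs AT `3` on
(KN₃)** — `sha_primary_finite_three_of_leafInputs_of_poitouTate_of_kodairaNeron` for
`(E, 3) ∈ ClassX11b W 3` (`r_an = 1 ∧ 3 ≠ 2 ∧ mult(3) ∧ irr(3)`, RESIDUAL-CASES §a.2 row X11b;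
only the conjunct `mult(3)` is used) at `N = N_E`, every number field `K : Type`: for `K`
imaginary quadratic with the Heegner hypothesis, `P` a non-torsion Heegner point and `ρ̄_{E,3}`
onto.  CONDITIONAL on EXACTLY {`hPT`, `hrec`, `hCM`, `h53`, `hγ`} at `3` + `hN` + (KN₃);
cite-only, NOT discharged; nothing booked; no mark / count / tier moves.
[cite: McCallumLMS1991, §1 Theorem (Kolyvagin)] [cite: GrossLMS1991, Thm. 1.3 (2)] -/
theorem sha_primary_finite_three_of_classX11b_of_kodairaNeron [NeZero N] [W.IsGloballyMinimal]
    (hW : ClassX11b W 3)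
    (hPT : Literature.NumberTheory.GaloisCohomology.poitouTate_sum_localTatePairing_eq_zero K)
    (hN : ∀ [W.IsElliptic], N = W.conductorNorm ℤ)
    (hrec : heegnerPointOfConductor_one_galoisConj N W K)
    (hCM : ∀ [W.IsElliptic] (_hK : IsImaginaryQuadratic K) (_hH : SatisfiesHeegnerHypothesis N K)
      (Dt : ModularParametrizationData W N) (β : ℤ) (ι : K →+* ℂ),
      (4 * N : ℤ) ∣ β ^ 2 - NumberField.discr K →
      ∀ {M : ℕ}, 1 ≤ M → ∀ (m : ℕ), Squarefree m →
      (∀ q ∈ m.primeFactors, IsKolyvaginPrime N W K 3 q ∧ FrobEqFrobInfty W K (3 ^ M) q) →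
      ∃ y : (W.baseChange (ringClassField K ι m)).toAffine.Point,
        WeierstrassCurve.Affine.Point.map (W' := W) (ringClassField K ι m).subtype.toRatAlgHom y =
          heegnerPointComplexOfConductor Dt (NumberField.discr K) β m)
    (h53 : ∀ [W.IsElliptic] (_hK : IsImaginaryQuadratic K) (_hH : SatisfiesHeegnerHypothesis N K)
      (Dt : ModularParametrizationData W N) (β : ℤ) (ι : K →+* ℂ) {M : ℕ}
      (_hM : 1 ≤ M) {n : ℕ} (_hn : Squarefree n)
      (_hKol : ∀ q ∈ n.primeFactors, IsKolyvaginPrime N W K 3 q ∧ FrobEqFrobInfty W K (3 ^ M) q)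
      (d : (m : ℕ) → m ∣ n → KolyvaginHeegnerData Dt β ι m) (m : ℕ) (hm : m ∣ n)
      (τm : ringClassField K ι m ≃ₐ[ℚ] ringClassField K ι m),
      (∀ x : ringClassField K ι m, ((τm x : ringClassField K ι m) : ℂ) = starRingEnd ℂ x) →
      ∃ σ' ∈ ringClassGal ι m, IsOfFinAddOrder
        (pointGalHom W (ringClassField K ι m) τm (d m hm).y -
          (-W.rootNumber) • pointGalHom W (ringClassField K ι m) σ' (d m hm).y))
    (hKN3m : ∀ [W.IsElliptic] (v : HeightOneSpectrum (𝓞 K)),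
      (W.baseChange K).HasMultiplicativeReductionAt v →
        ¬ 3 ∣ (W.baseChange K).ordMinimalDiscriminant v)
    (hKN3a : ∀ [W.IsElliptic] (v : HeightOneSpectrum (𝓞 K)),
      (W.baseChange K).HasAdditiveReductionAt v →
        (W.baseChange K).kodairaSymbolAt v ≠ KodairaSymbol.IV ∧
          (W.baseChange K).kodairaSymbolAt v ≠ KodairaSymbol.IVstar)
    (hγ : ∀ [W.IsElliptic] (_hK : IsImaginaryQuadratic K) (_hH : SatisfiesHeegnerHypothesis N K)
      (Dt : ModularParametrizationData W N) (β : ℤ) (ι : K →+* ℂ) {M : ℕ}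
      (_hM : 1 ≤ M) {n : ℕ} (_hn : Squarefree n)
      (_hKol : ∀ q ∈ n.primeFactors, IsKolyvaginPrime N W K 3 q ∧ FrobEqFrobInfty W K (3 ^ M) q)
      (d : (m : ℕ) → m ∣ n → KolyvaginHeegnerData Dt β ι m)
      (m : ℕ) (hm : m ∣ n) (ℓ : ℕ) (hℓ : ℓ ∈ m.primeFactors) [Fact ℓ.Prime]
      (hΔ : ¬ (ℓ : ℤ) ∣ minimalDiscriminantInt W) (φ₀ : absoluteGaloisGroup (ZMod ℓ)),
      (∀ x : AlgebraicClosure (ZMod ℓ), φ₀ • x = x ^ ℓ) →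
      ∀ (hle : ringClassField K ι (m / ℓ) ≤ ringClassField K ι m)
        (γ : ringClassField K ι m ≃ₐ[ℚ] ringClassField K ι m), γ ∈ ringClassGal ι m →
        geomReduction hΔ ((RatClosure.pointsEquiv (K := K) W).symm
            ((d m hm).toGeomPoints (pointGalHom W (ringClassField K ι m) γ (d m hm).y))) =
          φ₀ • geomReduction hΔ ((RatClosure.pointsEquiv (K := K) W).symm
            ((d m hm).toGeomPoints (pointGalHom W (ringClassField K ι m) γ
              (WeierstrassCurve.Affine.Point.map (W' := W)
                ((RingClassField.inclusion ι hle).restrictScalars ℚ)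
                (d (m / ℓ)
                  ((Nat.div_dvd_of_dvd (Nat.dvd_of_mem_primeFactors hℓ)).trans hm)).y))))) :
    ∀ [W.IsElliptic] (_hK : IsImaginaryQuadratic K) (_hH : SatisfiesHeegnerHypothesis N K)
      {P : (W.baseChange K).toAffine.Point} (_hP : IsHeegnerPoint N W K P)
      (_hnt : ¬ IsOfFinAddOrder P) (_hρ : W.HasSurjectiveModNGaloisRep 3),
      Set.Finite {c : (W.baseChange K).sha | ∃ j : ℕ, 3 ^ j • c = 0} :=
  sha_primary_finite_three_of_leafInputs_of_poitouTate_of_kodairaNeron hPT hN hW.2.2.1 hrec hCM h53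
    hKN3m hKN3a hγ

end Summit.BirchSwinnertonDyer.Rank1Residual.X11b.Three

end
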